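import Summits.CriticalPhenomena.PercolationContinuityZ3.Theorems.SahiMasterFamilyCBar
import Summits.CriticalPhenomena.PercolationContinuityZ3.Theorems.SahiMasterFamilyDefectPartition

/-!
# Tools for evaluating the (C̄) slack of a concrete pair, and the PINNED-BLOCK pair on 12 points (the counterexample to (C̄))

Unit `prim-masterthm-p4` (gen 27; crux anchor stmt-CriticalPhenomena-4575, helper work; memo
`run/shared/lean/prim/prim-masterthm/prim-masterthm-p4/P4-GEN27-REPORT.md` §3, note of record CBAR-REFUTATION.md).  Companion of `…DefectPartition`
(`badSum`, `badOn`, block expansion at any root) and `…CBar` (`rooted`, `capW`, `badBlocks`, `blockTerm`, `cbarSlack`, typed `CBar n`); consumed by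
`…CBarRefutation` (`cbarSlack (1/2) < 0` for the pair below, hence `¬ CBar 11`).
TOOLS (every `n`): `badOn_eq_sum_blocks` (`A(f|_R) = Σ_{B ⊆ R, B ∋ i} (|B|−1)!·(1 − e_B)·A(f|_{R∖B})`), `badOn_eq_zero_of_forall` (an index lying in no block
of nonzero defect kills `A`), `badOn_singleton`, `badOn_pair`, and **`capW_rooted_eq_badOn`: the cap term of the pair rooted at `z` is the partition
function of the ORIGINAL pair restricted to `univ ∖ {z}`** (no relabelling left); `mem_rooted`, `mix_rooted`.
THE PAIR PB(10): `T = Fin 12 = B ⊔ {x, y}`, `B = {0,…,9}` (`Bset`), pin `p = 0` (`pp`), `x = 10` (`xx`), `y = 11 = last` (`yy`);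
`𝒰 = famU = 2^T ∖ {{y}, {x,y}}`, `𝒱 = famV = 2^T ∖ ({{x}, {x,y}} ∪ {S ⊆ B : p ∈ S})`: both union-closed (`famU_uc`, `famV_uc`), both contain `univ`, the
only set in neither is the crossing pair `{x,y}` (`notMem_both_iff`); at `w = ½` the mixture is `½` on pinned subsets of the block (`mix_half_pset`), `1` on
every other set meeting the block (`mix_half_of_mem_Bset`), `β{x} = β{y} = ½`, `β{x,y} = 0`.
HONEST FRAMING: toolkit and book-keeping for a refutation.  Axioms standard. [this work]
-/

noncomputable section

open scoped Classical

namespace Summit.CriticalPhenomena.PercolationContinuityZ3.Theorems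

namespace CBarRefutation

open Finset Function Equiv
open Literature.Combinatorics.Sahi2008
open Literature.Combinatorics.Sahi2008.CycleForm
open PrincipalCapBeta (phiSet realF realW)
open BernsteinPos UCBernsteinNested RootSummed ComplementForm

section General

variable {α : Type*} [Fintype α]
variable {κ : Type*} [DecidableEq κ]

/-- **Block expansion of `A(f|_R)` at a root `i ∈ R`**, blocks written as subsets of the ambient index type. [this work] -/
theorem badOn_eq_sum_blocks (μ : α → ℝ) (f : κ → α → ℝ) {R : Finset κ} {i : κ} (hi : i ∈ R) :
    badOn μ f R = ∑ B ∈ R.powerset.filter (fun B => i ∈ B),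
      ((B.card - 1).factorial : ℝ) * ((1 - ex μ (fun x => ∏ j ∈ B, f j x)) * badOn μ f (R \ B)) := by
  unfold badOn
  rw [badSum_eq_sum_blocks μ (fun j : {x // x ∈ R} => f j) ⟨i, hi⟩]
  refine sum_nbij' (fun B' => B'.map (Embedding.subtype _)) (fun B => B.subtype _) ?_ ?_ ?_ ?_ ?_
  · intro B' hB'
    have hiB' : (⟨i, hi⟩ : {x // x ∈ R}) ∈ B' := (mem_filter.1 hB').2
    refine mem_filter.2 ⟨mem_powerset.2 fun x hx => property_of_mem_map_subtype B' hx, mem_map.2 ⟨⟨i, hi⟩, hiB', rfl⟩⟩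
  · intro B hB
    obtain ⟨_, hiB⟩ := mem_filter.1 hB
    exact mem_filter.2 ⟨mem_univ _, mem_subtype.2 hiB⟩
  · intro B' _
    ext y
    simp only [mem_subtype, mem_map, Embedding.coe_subtype]
    constructor
    · rintro ⟨a, ha, hay⟩; rwa [← Subtype.ext hay]
    · intro hy; exact ⟨y, hy, rfl⟩
  · intro B hB
    obtain ⟨hBR, _⟩ := mem_filter.1 hB
    exact subtype_map_of_mem fun x hx => mem_powerset.1 hBR hx
  · intro B' _
    rw [card_map, ex_prod_subtype, badSum_notMem_eq_badOn μ (fun j : {x // x ∈ R} => f j) B', badOn_restrict μ f _ (univ \ B')]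
    congr 3
    ext y
    simp only [mem_map, mem_sdiff, mem_univ, true_and, Embedding.coe_subtype]
    constructor
    · rintro ⟨a, ha, rfl⟩
      exact ⟨a.2, fun ⟨b, hb, hba⟩ => ha (by rwa [← Subtype.ext hba])⟩
    · rintro ⟨hyR, hyB⟩
      exact ⟨⟨y, hyR⟩, fun h => hyB ⟨_, h, rfl⟩, rfl⟩

/-- **Vanishing.**  If some index `q ∈ R` lies in no block of defect `≠ 0` (`e_B = 1` whenever `q ∈ B ⊆ R`), then `A(f|_R) = 0`. [this work] -/
theorem badOn_eq_zero_of_forall (μ : α → ℝ) (f : κ → α → ℝ) {R : Finset κ} {q : κ} (hq : q ∈ R)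
    (h : ∀ B, B ⊆ R → q ∈ B → ex μ (fun x => ∏ j ∈ B, f j x) = 1) : badOn μ f R = 0 := by
  rw [badOn_eq_sum_blocks μ f hq]
  refine sum_eq_zero fun B hB => ?_
  obtain ⟨hBR, hqB⟩ := mem_filter.1 hB
  rw [h B (mem_powerset.1 hBR) hqB]
  ring

/-- `A` on one index: `1 − e_{q}`. [this work] -/
theorem badOn_singleton (μ : α → ℝ) (f : κ → α → ℝ) (q : κ) :
    badOn μ f {q} = 1 - ex μ (fun x => ∏ j ∈ ({q} : Finset κ), f j x) := by
  rw [badOn_eq_sum_blocks μ f (mem_singleton_self q)]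
  have hS : ({q} : Finset κ).powerset.filter (fun B => q ∈ B) = {{q}} := by
    ext B
    simp only [mem_filter, mem_powerset, mem_singleton, subset_singleton_iff]
    constructor
    · rintro ⟨(rfl | rfl), hq⟩
      · exact absurd hq (notMem_empty q)
      · rfl
    · rintro rfl; exact ⟨Or.inr rfl, mem_singleton_self q⟩
  rw [hS, sum_singleton, card_singleton, Finset.sdiff_self, badOn_empty]
  simp

/-- `A` on two indices: `(1 − e_a)(1 − e_b) + (1 − e_{ab})`. [this work] -/
theorem badOn_pair (μ : α → ℝ) (f : κ → α → ℝ) {a b : κ} (hab : a ≠ b) :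
    badOn μ f {a, b} = (1 - ex μ (fun x => ∏ j ∈ ({a} : Finset κ), f j x)) * (1 - ex μ (fun x => ∏ j ∈ ({b} : Finset κ), f j x)) +
      (1 - ex μ (fun x => ∏ j ∈ ({a, b} : Finset κ), f j x)) := by
  rw [badOn_eq_sum_blocks μ f (mem_insert_self a {b})]
  have hS : ({a, b} : Finset κ).powerset.filter (fun B => a ∈ B) = {{a}, {a, b}} := by
    ext B
    simp only [mem_filter, mem_powerset, mem_insert, mem_singleton]
    constructor
    · rintro ⟨hsub, ha⟩
      by_cases hb : b ∈ B
      · right; ext y; simp only [mem_insert, mem_singleton]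
        constructor
        · intro hy; have := hsub hy; simpa using this
        · rintro (rfl | rfl); exacts [ha, hb]
      · left; ext y; simp only [mem_singleton]
        constructor
        · intro hy
          have := hsub hy
          simp only [mem_insert, mem_singleton] at this
          rcases this with rfl | rfl
          · rfl
          · exact absurd hy hb
        · rintro rfl; exact ha
    · rintro (rfl | rfl)
      · exact ⟨by simp, mem_singleton_self a⟩
      · exact ⟨subset_refl _, mem_insert_self a {b}⟩
  have hne : ({a} : Finset κ) ≠ {a, b} := by
    intro h
    have : b ∈ ({a} : Finset κ) := by rw [h]; simp
    exact hab (mem_singleton.1 this).symm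
  rw [hS, sum_insert (by simpa using hne), sum_singleton, card_singleton, card_pair hab]
  have h1 : ({a, b} : Finset κ) \ {a} = {b} := by
    ext y; simp only [mem_sdiff, mem_insert, mem_singleton]
    constructor
    · rintro ⟨(rfl | rfl), h⟩; exacts [absurd rfl h, rfl]
    · rintro rfl; exact ⟨Or.inr rfl, fun h => hab (h ▸ rfl)⟩
  rw [h1, badOn_singleton, Finset.sdiff_self, badOn_empty]
  simp

end General

/-! ### Rooted families and the rooted cap term -/

section Rooted

variable {n : ℕ}

/-- Membership in a rooted family. [this work] -/
theorem mem_rooted (z : Fin (n + 1)) (𝒰 : Finset (Finset (Fin (n + 1)))) (S : Finset (Fin (n + 1))) :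
    S ∈ rooted z 𝒰 ↔ S.map (Equiv.swap z (Fin.last n)).toEmbedding ∈ 𝒰 := by
  unfold rooted; exact mem_comap _ _ _

/-- The mixture of a rooted pair is the mixture of the pair at the relabelled set. [this work] -/
theorem mix_rooted (z : Fin (n + 1)) (𝒰 𝒱 : Finset (Finset (Fin (n + 1)))) (w : ℝ) (S : Finset (Fin (n + 1))) :
    mix (rooted z 𝒰) (rooted z 𝒱) w S = mix 𝒰 𝒱 w (S.map (Equiv.swap z (Fin.last n)).toEmbedding) := by
  unfold rooted
  exact (congrFun (mix_map (Equiv.swap z (Fin.last n)).toEmbedding 𝒰 𝒱 w) S).symm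

/-- The moments of the canonical signed model are the values of `β`. [this work] -/
theorem ex_realW_prod_fun' (β : Finset (Fin (n + 1)) → ℝ) (B : Finset (Fin (n + 1))) :
    ex (realW β) (fun x => ∏ i ∈ B, realF i x) = β B := by
  have e1 : (fun x => ∏ i ∈ B, realF i x) = ∏ i ∈ B, (realF i : Finset (Fin (n + 1)) → ℝ) :=
    funext fun x => (Finset.prod_apply x B _).symm
  rw [e1, PrincipalCapBeta.ex_realW_prod]

/-- **The rooted cap term is the punctured partition function of the original pair**:
`capW (rooted z 𝒰) (rooted z 𝒱) w = A(canonical model of w·1_𝒰 + (1−w)·1_𝒱 restricted to univ ∖ {z})`. [this work] -/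
theorem capW_rooted_eq_badOn (z : Fin (n + 1)) (𝒰 𝒱 : Finset (Finset (Fin (n + 1)))) (w : ℝ) :
    capW (rooted z 𝒰) (rooted z 𝒱) w = badOn (realW (mix 𝒰 𝒱 w)) (realF : Fin (n + 1) → Finset (Fin (n + 1)) → ℝ) (univ.erase z) := by
  -- the relabelling `j ↦ swap z last (castSucc j)` is a bijection `Fin n ≃ univ ∖ {z}`
  let sw : Fin (n + 1) ↪ Fin (n + 1) := (Equiv.swap z (Fin.last n)).toEmbedding
  let g : Fin n → {x // x ∈ (univ : Finset (Fin (n + 1))).erase z} := fun j =>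
    ⟨sw (Fin.castSucc j), mem_erase.2 ⟨by
      intro h
      have h' : Equiv.swap z (Fin.last n) (Fin.castSucc j) = z := h
      rw [Equiv.swap_apply_eq_iff, Equiv.swap_apply_left] at h'
      exact Fin.castSucc_ne_last j h', mem_univ _⟩⟩
  have hg_inj : Function.Injective g := by
    intro j₁ j₂ h
    have h' : sw (Fin.castSucc j₁) = sw (Fin.castSucc j₂) := congrArg Subtype.val h
    exact Fin.castSucc_injective n (sw.injective h')
  have hg_bij : Function.Bijective g := by
    rw [Fintype.bijective_iff_injective_and_card]
    refine ⟨hg_inj, ?_⟩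
    rw [Fintype.card_fin, Fintype.card_coe, card_erase_of_mem (mem_univ z), card_univ, Fintype.card_fin]
    rfl
  let E : Fin n ≃ {x // x ∈ (univ : Finset (Fin (n + 1))).erase z} := Equiv.ofBijective g hg_bij
  unfold badOn
  rw [← badSum_comp_equiv (realW (mix 𝒰 𝒱 w)) E]
  unfold capW badSum
  refine sum_congr rfl fun σ _ => prod_congr rfl fun B _ => ?_
  rw [mix_rooted]
  congr 1
  have e1 : (fun x => ∏ i ∈ B, realF ((E i : {x // x ∈ (univ : Finset (Fin (n + 1))).erase z}) : Fin (n + 1)) x) =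
      fun x => ∏ i ∈ (B.map Fin.castSuccEmb).map sw, realF i x := by
    funext x
    rw [prod_map, prod_map]
    rfl
  rw [e1, ex_realW_prod_fun']

end Rooted

/-! ### The pinned-block pair on 12 points -/

/-- The pin `p = 0`. [this work] -/
abbrev pp : Fin 12 := 0
/-- The point `x = 10` (in `𝒰 ∖ 𝒱` as a singleton). [this work] -/
abbrev xx : Fin 12 := 10
/-- The point `y = 11 = last` (in `𝒱 ∖ 𝒰` as a singleton). [this work] -/
abbrev yy : Fin 12 := Fin.last 11
/-- The block `B = T ∖ {x, y} = {0,…,9}`. [this work] -/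
abbrev Bset : Finset (Fin 12) := univ \ {xx, yy}
/-- `𝒰 = 2^T ∖ {{y}, {x,y}}`. [this work] -/
def famU : Finset (Finset (Fin 12)) := univ.filter fun S => S ≠ {yy} ∧ S ≠ {xx, yy}
/-- `𝒱 = 2^T ∖ ({{x}, {x,y}} ∪ {S ⊆ B : p ∈ S})`. [this work] -/
def famV : Finset (Finset (Fin 12)) := univ.filter fun S => S ≠ {xx} ∧ S ≠ {xx, yy} ∧ ¬ (pp ∈ S ∧ S ⊆ Bset)

/-- `x ≠ y`. [this work] -/
theorem xx_ne_yy : xx ≠ yy := by decide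
/-- `p ≠ x`. [this work] -/
theorem pp_ne_xx : pp ≠ xx := by decide
/-- `p ≠ y`. [this work] -/
theorem pp_ne_yy : pp ≠ yy := by decide
/-- Membership in the block. [this work] -/
theorem mem_Bset (q : Fin 12) : q ∈ Bset ↔ q ≠ xx ∧ q ≠ yy := by
  unfold Bset; simp
/-- The pin lies in the block. [this work] -/
theorem pp_mem_Bset : pp ∈ Bset := (mem_Bset pp).2 ⟨pp_ne_xx, pp_ne_yy⟩
/-- Membership in `𝒰`. [this work] -/
theorem mem_famU (S : Finset (Fin 12)) : S ∈ famU ↔ S ≠ {yy} ∧ S ≠ {xx, yy} := by unfold famU; simp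
/-- Membership in `𝒱`. [this work] -/
theorem mem_famV (S : Finset (Fin 12)) : S ∈ famV ↔ S ≠ {xx} ∧ S ≠ {xx, yy} ∧ ¬ (pp ∈ S ∧ S ⊆ Bset) := by unfold famV; simp

/-- A subset of `{y}` other than `{y}` is empty; a subset of `{x,y}` containing `y` is `{y}` or `{x,y}`. [folklore] -/
theorem eq_of_subset_pair {S : Finset (Fin 12)} {a b : Fin 12} (h : S ⊆ {a, b}) (hb : b ∈ S) : S = {b} ∨ S = {a, b} := by
  by_cases ha : a ∈ S
  · right; ext t; constructor
    · exact fun ht => h ht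
    · intro ht; rcases mem_insert.1 ht with rfl | ht
      · exact ha
      · rw [mem_singleton.1 ht]; exact hb
  · left; ext t; constructor
    · intro ht
      rcases mem_insert.1 (h ht) with rfl | ht'
      · exact absurd ht ha
      · exact ht'
    · intro ht; rw [mem_singleton.1 ht]; exact hb

/-- `𝒰` is union-closed. [this work] -/
theorem famU_uc : ∀ A ∈ famU, ∀ B ∈ famU, A ∪ B ∈ famU := by
  intro A hA B hB
  rw [mem_famU] at hA hB ⊢
  constructor
  · intro h
    have hy : yy ∈ A ∪ B := by rw [h]; exact mem_singleton_self _
    rcases mem_union.1 hy with hyA | hyB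
    · rcases eq_of_subset_pair (a := xx) (fun t ht => by
        have : t ∈ A ∪ B := mem_union_left _ ht
        rw [h] at this; exact mem_insert_of_mem this) hyA with h1 | h1
      · exact hA.1 h1
      · exact hA.2 h1
    · rcases eq_of_subset_pair (a := xx) (fun t ht => by
        have : t ∈ A ∪ B := mem_union_right _ ht
        rw [h] at this; exact mem_insert_of_mem this) hyB with h1 | h1
      · exact hB.1 h1
      · exact hB.2 h1
  · intro h
    have hy : yy ∈ A ∪ B := by rw [h]; exact mem_insert_of_mem (mem_singleton_self _)
    rcases mem_union.1 hy with hyA | hyB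
    · rcases eq_of_subset_pair (fun t ht => by have : t ∈ A ∪ B := mem_union_left _ ht; rwa [h] at this) hyA with h1 | h1
      · exact hA.1 h1
      · exact hA.2 h1
    · rcases eq_of_subset_pair (fun t ht => by have : t ∈ A ∪ B := mem_union_right _ ht; rwa [h] at this) hyB with h1 | h1
      · exact hB.1 h1
      · exact hB.2 h1

/-- `𝒱` is union-closed. [this work] -/
theorem famV_uc : ∀ A ∈ famV, ∀ B ∈ famV, A ∪ B ∈ famV := by
  intro A hA B hB
  rw [mem_famV] at hA hB ⊢
  refine ⟨fun h => ?_, fun h => ?_, fun h => ?_⟩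
  · have hx : xx ∈ A ∪ B := by rw [h]; exact mem_singleton_self _
    rcases mem_union.1 hx with hxA | hxB
    · rcases eq_of_subset_pair (a := xx) (b := xx) (fun t ht => by
        have : t ∈ A ∪ B := mem_union_left _ ht
        rw [h] at this; exact mem_insert_of_mem this) hxA with h1 | h1
      · exact hA.1 h1
      · exact hA.1 (by rw [h1]; simp)
    · rcases eq_of_subset_pair (a := xx) (b := xx) (fun t ht => by
        have : t ∈ A ∪ B := mem_union_right _ ht
        rw [h] at this; exact mem_insert_of_mem this) hxB with h1 | h1
      · exact hB.1 h1
      · exact hB.1 (by rw [h1]; simp)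
  · -- `A ∪ B = {x, y}`: the part containing `x` is `{x}` or `{x,y}` (note the pair is `{y, x}` up to order)
    have hx : xx ∈ A ∪ B := by rw [h]; exact mem_insert_self _ _
    have hsub : ∀ t ∈ A ∪ B, t ∈ ({yy, xx} : Finset (Fin 12)) := by
      intro t ht; rw [h] at ht; simp only [mem_insert, mem_singleton] at ht ⊢; tauto
    rcases mem_union.1 hx with hxA | hxB
    · rcases eq_of_subset_pair (fun t ht => hsub t (mem_union_left _ ht)) hxA with h1 | h1
      · exact hA.1 h1
      · exact hA.2.1 (by rw [h1]; exact Finset.pair_comm _ _)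
    · rcases eq_of_subset_pair (fun t ht => hsub t (mem_union_right _ ht)) hxB with h1 | h1
      · exact hB.1 h1
      · exact hB.2.1 (by rw [h1]; exact Finset.pair_comm _ _)
  · obtain ⟨hp, hsub⟩ := h
    rcases mem_union.1 hp with hpA | hpB
    · exact hA.2.2 ⟨hpA, subset_union_left.trans hsub⟩
    · exact hB.2.2 ⟨hpB, subset_union_right.trans hsub⟩

/-- `univ ∈ 𝒰`. [this work] -/
theorem univ_mem_famU : (univ : Finset (Fin 12)) ∈ famU := by
  rw [mem_famU]; constructor <;> intro h <;> have := h ▸ mem_univ pp <;> revert this <;> decide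
/-- `univ ∈ 𝒱`. [this work] -/
theorem univ_mem_famV : (univ : Finset (Fin 12)) ∈ famV := by
  rw [mem_famV]
  refine ⟨fun h => ?_, fun h => ?_, fun h => ?_⟩
  · have := h ▸ mem_univ pp; revert this; decide
  · have := h ▸ mem_univ pp; revert this; decide
  · have := h.2 (mem_univ xx); revert this; decide

/-! ### The defects at `w = ½` -/

/-- The mixture point at `w = ½`. [this work] -/
theorem mix_half (S : Finset (Fin 12)) :
    mix famU famV (1 / 2) S = (1 / 2) * (if S ∈ famU then 1 else 0) + (1 / 2) * (if S ∈ famV then 1 else 0) := by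
  unfold mix; norm_num

/-- A set in both families has mixture value `1` (defect `0`). [this work] -/
theorem mix_half_of_mem_mem {S : Finset (Fin 12)} (hU : S ∈ famU) (hV : S ∈ famV) : mix famU famV (1 / 2) S = 1 := by
  rw [mix_half, if_pos hU, if_pos hV]; norm_num

/-- A set through the pin inside the block is in `𝒰 ∖ 𝒱`: defect `½`. [this work] -/
theorem mix_half_pset {S : Finset (Fin 12)} (hp : pp ∈ S) (hS : S ⊆ Bset) : mix famU famV (1 / 2) S = 1 / 2 := by
  have hU : S ∈ famU := by
    rw [mem_famU]
    constructor
    · intro h; rw [h] at hp; exact pp_ne_yy (mem_singleton.1 hp)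
    · intro h; rw [h] at hp
      rcases mem_insert.1 hp with h1 | h1
      · exact pp_ne_xx h1
      · exact pp_ne_yy (mem_singleton.1 h1)
  have hV : S ∉ famV := by rw [mem_famV]; exact fun h => h.2.2 ⟨hp, hS⟩
  rw [mix_half, if_pos hU, if_neg hV]; norm_num

/-- A set meeting the block at `q` but not a pinned subset of the block is in both families: defect `0`. [this work] -/
theorem mix_half_of_mem_Bset {S : Finset (Fin 12)} {q : Fin 12} (hq : q ∈ Bset) (hqS : q ∈ S) (h : ¬ (pp ∈ S ∧ S ⊆ Bset)) :
    mix famU famV (1 / 2) S = 1 := by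
  obtain ⟨hqx, hqy⟩ := (mem_Bset q).1 hq
  have h1 : S ≠ {yy} := fun h => hqy (by rw [h] at hqS; exact mem_singleton.1 hqS)
  have h2 : S ≠ {xx, yy} := fun h => by
    rw [h] at hqS; simp only [mem_insert, mem_singleton] at hqS; tauto
  have h3 : S ≠ {xx} := fun h => hqx (by rw [h] at hqS; exact mem_singleton.1 hqS)
  exact mix_half_of_mem_mem ((mem_famU S).2 ⟨h1, h2⟩) ((mem_famV S).2 ⟨h3, h2, h⟩)

/-- `β{x} = ½`. [this work] -/
theorem mix_half_x : mix famU famV (1 / 2) {xx} = 1 / 2 := by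
  have hU : ({xx} : Finset (Fin 12)) ∈ famU := by rw [mem_famU]; decide
  have hV : ({xx} : Finset (Fin 12)) ∉ famV := by rw [mem_famV]; simp
  rw [mix_half, if_pos hU, if_neg hV]; norm_num
/-- `β{y} = ½`. [this work] -/
theorem mix_half_y : mix famU famV (1 / 2) {yy} = 1 / 2 := by
  have hU : ({yy} : Finset (Fin 12)) ∉ famU := by rw [mem_famU]; simp
  have hV : ({yy} : Finset (Fin 12)) ∈ famV := by rw [mem_famV]; decide
  rw [mix_half, if_neg hU, if_pos hV]; norm_num
/-- `β{x,y} = 0` (the crossing pair lies in neither family). [this work] -/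
theorem mix_half_xy : mix famU famV (1 / 2) {xx, yy} = 0 := by
  have hU : ({xx, yy} : Finset (Fin 12)) ∉ famU := by rw [mem_famU]; simp
  have hV : ({xx, yy} : Finset (Fin 12)) ∉ famV := by rw [mem_famV]; simp
  rw [mix_half, if_neg hU, if_neg hV]; norm_num

/-- The only set in neither family is the crossing pair `{x, y}`. [this work] -/
theorem notMem_both_iff (S : Finset (Fin 12)) : (S ∉ famU ∧ S ∉ famV) ↔ S = {xx, yy} := by
  constructor
  · rintro ⟨hU, hV⟩
    rw [mem_famU] at hU; rw [mem_famV] at hV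
    by_contra hne
    have hU' : S = {yy} := by by_contra h; exact hU ⟨h, hne⟩
    apply hV
    refine ⟨by rw [hU']; decide, hne, fun ⟨hp, _⟩ => ?_⟩
    rw [hU'] at hp; exact pp_ne_yy (mem_singleton.1 hp)
  · rintro rfl
    exact ⟨fun h => ((mem_famU _).1 h).2 rfl, fun h => ((mem_famV _).1 h).2.1 rfl⟩

end CBarRefutation

end Summit.CriticalPhenomena.PercolationContinuityZ3.Theorems
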